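import Summits.Schanuel.Schanuel.Theorems.SoloInformedAE1GelfondInput

/-!
# Theorem AE-1: `ν > 4 + β − 4σ` is an exponent of Roy's additive small value estimate

Soloist file (informed mode, seat `solo-Schanuel-informed`, s179).  The kernel form of the
seat's THEOREM AE-1 (`paper/AE-note.md` §7, `η = 0` form) on the node
`RoyAdditiveDirichletExponent` ([cite: Roy2010, Thm 1.1], the additive small value estimate;
Roy's question there is whether every `ν > 1 + β − σ − τ` is an exponent):

  for `ξ ∈ ℂ` transcendental, `β > 1` and `0 < σ < 1` (any `τ`), every `ν > 4 + β − 4σ` lies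
  in `royAdditiveSVEExponents ξ β σ τ` — i.e. for infinitely many `n` there is NO non-zero
  `P ∈ ℤ[X]` with `deg P ≤ n`, `H(P) ≤ exp(n^β)` and `|P^{[j]}(iξ)| ≤ exp(-n^ν)` for all
  naturals `i ≤ n^σ`, `j ≤ n^τ`.

This improves the one-point Gel'fond ceiling `ν > 1 + β`
(`Ioi_subset_royAdditiveSVEExponents`) exactly when `σ > 3/4`, using only the points `iξ`
(no derivatives).  Proof: `soloGI_gelfond_input` turns Roy's data at every large `n` into a
non-zero `Q_n ∈ ℤ[X]` of degree `O(n^{1-σ})`, type `O(n^{1-σ} log n + n^{β-σ})` and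
`|Q_n(ξ)| ≤ exp(-n^ν K / (400 n))`, `K = ⌊n^σ⌋`; the tree's Gel'fond criterion
(`Literature.NumberTheory.Transcendental.gelfond_criterion_not_small_values`, run with the
sequences `(N+1)^{e₁}`, `(N+1)^{e₂}`, `e₁ = 1 − σ + κ`, `e₂ = β − σ + κ`, `κ = (1 − σ)/2`,
ratio `a = 2^{e₂} + 1`) forbids this because `e₁ + e₂ = 2 + β − 3σ < ν + σ − 1`.  The binding
constraint `ν > 4 + β − 4σ` is THEOREM C's count of inexact additive coincidences
(`soloSR_structured_roots`).  This file is the asymptotic bookkeeping (`soloT1_cond*`) and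
the assembly `soloT1_Ioi_subset_royAdditiveSVEExponents`.

What this is NOT.  Not the node `RoyAdditiveDirichletExponent` (threshold `1 + β − σ − τ`),
which stays open; the window `(1 + β − σ − τ, 4 + β − 4σ]` is untouched, and nothing here
bears on `Literature.Periods.SchanuelConjecture` (the seat's verdict, no path, is unchanged).
The argument is the seat's own (AE-note §2–§7); the ingredients are classical (Gel'fond's
criterion, Mahler measure, Lemma H) and no literature hypothesis is used: tree files and
Mathlib only; no definitions; axioms the standard three.
-/

namespace Summit.Schanuel.Schanuel.Theorems

open Polynomial Finset Filter

/-! ## The comparison sequences `(N+1)^e` of Gel'fond's criterion -/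

/-- `N ↦ (N+1)^e` (`e > 0`) is monotone, positive, tends to `∞`, and grows by at most the
factor `2^e` from `N` to `N + 1`. -/
theorem soloT1_seq {e : ℝ} (he : 0 < e) :
    Monotone (fun N : ℕ => ((N : ℝ) + 1) ^ e) ∧ (∀ N : ℕ, 0 < ((N : ℝ) + 1) ^ e) ∧
      Tendsto (fun N : ℕ => ((N : ℝ) + 1) ^ e) atTop atTop ∧
      ∀ N : ℕ, (((N + 1 : ℕ) : ℝ) + 1) ^ e ≤ (2 : ℝ) ^ e * ((N : ℝ) + 1) ^ e := by
  refine ⟨?_, fun N => by positivity, ?_, ?_⟩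
  · intro x y h
    have : (x : ℝ) ≤ y := Nat.cast_le.mpr h
    exact Real.rpow_le_rpow (by positivity) (by linarith) he.le
  · exact (tendsto_rpow_atTop he).comp
      (tendsto_atTop_add_const_right atTop (1 : ℝ) tendsto_natCast_atTop_atTop)
  · intro N
    push_cast
    rw [← Real.mul_rpow (by norm_num) (by positivity)]
    exact Real.rpow_le_rpow (by positivity) (by linarith) he.le

/-! ## Eventual inequalities (`K = ⌊n^σ⌋`) -/

/-- Eventually `n ≥ 1`, `K = ⌊n^σ⌋ ≥ 1000` and `n^σ / 2 ≤ K ≤ n^σ`. -/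
theorem soloT1_floor {σ : ℝ} (hσ0 : 0 < σ) :
    ∀ᶠ n : ℕ in atTop, (1 : ℝ) ≤ n ∧ 1000 ≤ ⌊(n : ℝ) ^ σ⌋₊ ∧
      (⌊(n : ℝ) ^ σ⌋₊ : ℝ) ≤ (n : ℝ) ^ σ ∧ (n : ℝ) ^ σ / 2 ≤ ⌊(n : ℝ) ^ σ⌋₊ := by
  filter_upwards [eventually_ge_atTop 1, eventually_const_mul_rpow_le_rpow hσ0 2000]
    with n hn h
  have hn1 : (1 : ℝ) ≤ n := by exact_mod_cast hn
  rw [Real.rpow_zero, mul_one] at h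
  have hpos : 0 ≤ (n : ℝ) ^ σ := by positivity
  have hfl : (n : ℝ) ^ σ - 1 < ⌊(n : ℝ) ^ σ⌋₊ := Nat.sub_one_lt_floor _
  refine ⟨hn1, ?_, Nat.floor_le hpos, by linarith⟩
  have : (1000 : ℝ) ≤ ⌊(n : ℝ) ^ σ⌋₊ := by linarith
  exact_mod_cast this

/-- `W / 2 = n^ν K / (400 n) ≥ n^{ν+σ-1} / 800` when `K ≥ n^σ / 2`. -/
theorem soloT1_W_lower {σ ν : ℝ} {n : ℕ} (hn : (1 : ℝ) ≤ n) {K : ℝ}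
    (hK : (n : ℝ) ^ σ / 2 ≤ K) :
    (n : ℝ) ^ (ν + σ - 1) / 800 ≤ (n : ℝ) ^ ν * K / (400 * n) := by
  have hn0 : (0 : ℝ) < n := by linarith
  rw [Real.rpow_sub hn0, Real.rpow_add hn0, Real.rpow_one]
  calc (n : ℝ) ^ ν * (n : ℝ) ^ σ / n / 800 = (n : ℝ) ^ ν * ((n : ℝ) ^ σ / 2) / (400 * n) := by
        field_simp
        ring
    _ ≤ (n : ℝ) ^ ν * K / (400 * n) := by gcongr

/-- `20 n / K ≤ 40 n^{1-σ}` and `40 n^β / K ≤ 80 n^{β-σ}` when `K ≥ n^σ / 2 > 0`. -/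
theorem soloT1_over_K {β σ : ℝ} {n : ℕ} (hn : (1 : ℝ) ≤ n) {K : ℝ} (hK0 : 0 < K)
    (hK : (n : ℝ) ^ σ / 2 ≤ K) :
    20 * (n : ℝ) / K ≤ 40 * (n : ℝ) ^ (1 - σ) ∧
      40 * (n : ℝ) ^ β / K ≤ 80 * (n : ℝ) ^ (β - σ) := by
  have hn0 : (0 : ℝ) < n := by linarith
  have hσpos : 0 < (n : ℝ) ^ σ := by positivity
  constructor
  · rw [Real.rpow_sub hn0, Real.rpow_one, div_le_iff₀ hK0]
    calc 20 * (n : ℝ) = 40 * ((n : ℝ) / (n : ℝ) ^ σ) * ((n : ℝ) ^ σ / 2) := by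
          field_simp
          ring
      _ ≤ 40 * ((n : ℝ) / (n : ℝ) ^ σ) * K := mul_le_mul_of_nonneg_left hK (by positivity)
  · rw [Real.rpow_sub hn0, div_le_iff₀ hK0]
    calc 40 * (n : ℝ) ^ β = 80 * ((n : ℝ) ^ β / (n : ℝ) ^ σ) * ((n : ℝ) ^ σ / 2) := by
          field_simp
          ring
      _ ≤ 80 * ((n : ℝ) ^ β / (n : ℝ) ^ σ) * K := mul_le_mul_of_nonneg_left hK (by positivity)

/-- (A) eventually `2 c₁ n ≤ n^ν` (`ν > 1`). -/
theorem soloT1_condA {ν : ℝ} (hν : 1 < ν) (c₁ : ℝ) :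
    ∀ᶠ n : ℕ in atTop, 2 * c₁ * n ≤ (n : ℝ) ^ ν := by
  filter_upwards [eventually_const_mul_rpow_le_rpow hν (2 * c₁)] with n h
  rwa [Real.rpow_one] at h

/-- (B) eventually `exp(-W) ≤ 1/2` and `4 exp(-W) ≤ ‖ξ‖`, `W = n^ν K / (200 n)`. -/
theorem soloT1_condB {ξ : ℂ} (hξ0 : ξ ≠ 0) {σ ν : ℝ} (hσ0 : 0 < σ) (hm : 0 < ν + σ - 1) :
    ∀ᶠ n : ℕ in atTop,
      Real.exp (-((n : ℝ) ^ ν * ⌊(n : ℝ) ^ σ⌋₊ / (200 * n))) ≤ 1 / 2 ∧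
        4 * Real.exp (-((n : ℝ) ^ ν * ⌊(n : ℝ) ^ σ⌋₊ / (200 * n))) ≤ ‖ξ‖ := by
  have hξpos : 0 < ‖ξ‖ := norm_pos_iff.mpr hξ0
  filter_upwards [soloT1_floor hσ0,
    eventually_const_mul_rpow_le_rpow hm (400 * (2 + 4 / ‖ξ‖))] with n ⟨hn1, hK, hKle, hKge⟩ h
  rw [Real.rpow_zero, mul_one] at h
  set W : ℝ := (n : ℝ) ^ ν * ⌊(n : ℝ) ^ σ⌋₊ / (200 * n) with hW
  have hWlow := soloT1_W_lower (ν := ν) hn1 hKge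
  have hWhalf : (n : ℝ) ^ ν * ⌊(n : ℝ) ^ σ⌋₊ / (400 * n) = W / 2 := by rw [hW]; ring
  have hW2 : 2 + 4 / ‖ξ‖ ≤ W := by linarith
  have hexp : Real.exp (-W) ≤ 1 / (W + 1) := by
    rw [Real.exp_neg, ← one_div]
    exact one_div_le_one_div_of_le (by positivity) (Real.add_one_le_exp W)
  have h4 : 0 < 4 / ‖ξ‖ := by positivity
  constructor
  · calc Real.exp (-W) ≤ 1 / (W + 1) := hexp
      _ ≤ 1 / 2 := one_div_le_one_div_of_le (by norm_num) (by linarith)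
  · have : Real.exp (-W) ≤ ‖ξ‖ / 4 := by
      calc Real.exp (-W) ≤ 1 / (W + 1) := hexp
        _ ≤ 1 / (4 / ‖ξ‖) := one_div_le_one_div_of_le h4 (by linarith)
        _ = ‖ξ‖ / 4 := by rw [one_div, inv_div]
    linarith

/-- (C) eventually `log (8 (K‖ξ‖ + 1)) ≤ W / 2` (`ν > 1`). -/
theorem soloT1_condC (ξ : ℂ) {σ ν : ℝ} (hσ0 : 0 < σ) (hν : 1 < ν) :
    ∀ᶠ n : ℕ in atTop, Real.log (8 * (⌊(n : ℝ) ^ σ⌋₊ * ‖ξ‖ + 1)) ≤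
      (n : ℝ) ^ ν * ⌊(n : ℝ) ^ σ⌋₊ / (400 * n) := by
  filter_upwards [soloT1_floor hσ0,
    eventually_const_mul_rpow_le_rpow hν (3200 * (‖ξ‖ + 1))] with n ⟨hn1, hK, hKle, hKge⟩ h
  rw [Real.rpow_one] at h
  have hn0 : (0 : ℝ) < n := by linarith
  have hK1 : (1 : ℝ) ≤ ⌊(n : ℝ) ^ σ⌋₊ := by
    exact_mod_cast (show 1 ≤ ⌊(n : ℝ) ^ σ⌋₊ by omega)
  set K : ℝ := (↑⌊(n : ℝ) ^ σ⌋₊ : ℝ) with hKdef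
  have hξ0 : 0 ≤ ‖ξ‖ := norm_nonneg ξ
  have hlog : Real.log (8 * (K * ‖ξ‖ + 1)) ≤ 8 * K * (‖ξ‖ + 1) := by
    have := Real.log_le_sub_one_of_pos (by positivity : 0 < 8 * (K * ‖ξ‖ + 1))
    nlinarith
  have hmain : 8 * K * (‖ξ‖ + 1) ≤ (n : ℝ) ^ ν * K / (400 * n) := by
    rw [le_div_iff₀ (by positivity)]
    have := mul_le_mul_of_nonneg_right h (zero_le_one.trans hK1)
    linarith
  exact hlog.trans hmain

/-- (D) eventually `4·10⁷ n⁴ n^β ≤ K⁴ n^ν` — THIS is where `ν > 4 + β − 4σ` is used. -/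
theorem soloT1_condD {β σ ν : ℝ} (hσ0 : 0 < σ) (hν : 4 + β - 4 * σ < ν) :
    ∀ᶠ n : ℕ in atTop, 40000000 * ((n : ℝ) ^ 4 * (n : ℝ) ^ β) ≤
      (⌊(n : ℝ) ^ σ⌋₊ : ℝ) ^ 4 * (n : ℝ) ^ ν := by
  have hlt : 4 + β < 4 * σ + ν := by linarith
  filter_upwards [soloT1_floor hσ0, eventually_const_mul_rpow_le_rpow hlt 640000000]
    with n ⟨hn1, hK, hKle, hKge⟩ h
  have hn0 : (0 : ℝ) < n := by linarith
  have e1 : (n : ℝ) ^ 4 * (n : ℝ) ^ β = (n : ℝ) ^ (4 + β) := by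
    rw [Real.rpow_add hn0, show (4 : ℝ) = ((4 : ℕ) : ℝ) by norm_num, Real.rpow_natCast]
  have e2 : (n : ℝ) ^ (4 * σ + ν) = ((n : ℝ) ^ σ) ^ 4 * (n : ℝ) ^ ν := by
    rw [Real.rpow_add hn0, mul_comm (4 : ℝ) σ, Real.rpow_mul hn0.le,
      show (4 : ℝ) = ((4 : ℕ) : ℝ) by norm_num, Real.rpow_natCast]
  have hK4 : ((n : ℝ) ^ σ) ^ 4 / 16 ≤ (⌊(n : ℝ) ^ σ⌋₊ : ℝ) ^ 4 := by
    have := pow_le_pow_left₀ (by positivity : 0 ≤ (n : ℝ) ^ σ / 2) hKge 4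
    calc ((n : ℝ) ^ σ) ^ 4 / 16 = ((n : ℝ) ^ σ / 2) ^ 4 := by ring
      _ ≤ _ := this
  calc 40000000 * ((n : ℝ) ^ 4 * (n : ℝ) ^ β) = 40000000 * (n : ℝ) ^ (4 + β) := by rw [e1]
    _ ≤ (n : ℝ) ^ (4 * σ + ν) / 16 := by linarith
    _ = ((n : ℝ) ^ σ) ^ 4 / 16 * (n : ℝ) ^ ν := by rw [e2]; ring
    _ ≤ (⌊(n : ℝ) ^ σ⌋₊ : ℝ) ^ 4 * (n : ℝ) ^ ν :=
        mul_le_mul_of_nonneg_right hK4 (by positivity)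

/-- (E) eventually `(20 n / K) log (K‖ξ‖ + 1) + 40 n^β / K ≤ W / 2`. -/
theorem soloT1_condE (ξ : ℂ) {β σ ν : ℝ} (hσ0 : 0 < σ) (hm1 : 1 < ν + σ - 1)
    (hm2 : β - σ < ν + σ - 1) :
    ∀ᶠ n : ℕ in atTop,
      20 * n / ⌊(n : ℝ) ^ σ⌋₊ * Real.log (⌊(n : ℝ) ^ σ⌋₊ * ‖ξ‖ + 1) +
        40 * (n : ℝ) ^ β / ⌊(n : ℝ) ^ σ⌋₊ ≤ (n : ℝ) ^ ν * ⌊(n : ℝ) ^ σ⌋₊ / (400 * n) := by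
  filter_upwards [soloT1_floor hσ0, eventually_const_mul_rpow_le_rpow hm1 (32000 * ‖ξ‖),
    eventually_const_mul_rpow_le_rpow hm2 128000] with n ⟨hn1, hK, hKle, hKge⟩ ha hb
  rw [Real.rpow_one] at ha
  have hn0 : (0 : ℝ) < n := by linarith
  have hK0 : (0 : ℝ) < ⌊(n : ℝ) ^ σ⌋₊ := by
    exact_mod_cast (show 0 < ⌊(n : ℝ) ^ σ⌋₊ by omega)
  set K : ℝ := (↑⌊(n : ℝ) ^ σ⌋₊ : ℝ) with hKdef
  have hξ0 : 0 ≤ ‖ξ‖ := norm_nonneg ξ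
  have t1 : 20 * n / K * Real.log (K * ‖ξ‖ + 1) ≤ 20 * n * ‖ξ‖ := by
    have hl : Real.log (K * ‖ξ‖ + 1) ≤ K * ‖ξ‖ := by
      have := Real.log_le_sub_one_of_pos (by positivity : 0 < K * ‖ξ‖ + 1)
      linarith
    calc 20 * n / K * Real.log (K * ‖ξ‖ + 1) ≤ 20 * n / K * (K * ‖ξ‖) :=
          mul_le_mul_of_nonneg_left hl (by positivity)
      _ = 20 * n * ‖ξ‖ := by field_simp
  have t2 := (soloT1_over_K (β := β) hn1 hK0 hKge).2
  have t3 := soloT1_W_lower (ν := ν) hn1 hKge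
  linarith

/-- (F) eventually the degree bound `20 n / K` is below `(n+1)^{e₁}` (`e₁ > 1 − σ`). -/
theorem soloT1_condF {σ e₁ : ℝ} (hσ0 : 0 < σ) (hσ1 : σ < 1) (he : 1 - σ < e₁) :
    ∀ᶠ n : ℕ in atTop, 20 * (n : ℝ) / ⌊(n : ℝ) ^ σ⌋₊ < ((n : ℝ) + 1) ^ e₁ := by
  filter_upwards [soloT1_floor hσ0, eventually_const_mul_rpow_le_rpow he 41]
    with n ⟨hn1, hK, hKle, hKge⟩ h
  have hn0 : (0 : ℝ) < n := by linarith
  have hK0 : (0 : ℝ) < ⌊(n : ℝ) ^ σ⌋₊ := by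
    exact_mod_cast (show 0 < ⌊(n : ℝ) ^ σ⌋₊ by omega)
  have t := (soloT1_over_K (β := 1) hn1 hK0 hKge).1
  have hpos : 0 < (n : ℝ) ^ (1 - σ) := by positivity
  have hmono : (n : ℝ) ^ e₁ ≤ ((n : ℝ) + 1) ^ e₁ :=
    Real.rpow_le_rpow hn0.le (by linarith) (by linarith)
  linarith

/-- (G) eventually the type bound `(20 n / K)(2 + log K) + 40 n^β / K` is below
`(n+1)^{e₂}` (`e₂ > 1 − σ + κ/2`, `e₂ > β − σ`, `κ > 0`; `log K ≤ log n ≤ (2/κ) n^{κ/2}`). -/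
theorem soloT1_condG {β σ e₂ κ : ℝ} (hσ0 : 0 < σ) (hσ1 : σ < 1) (hκ : 0 < κ)
    (he1 : 1 - σ < e₂) (he2 : 1 - σ + κ / 2 < e₂) (he3 : β - σ < e₂) :
    ∀ᶠ n : ℕ in atTop,
      20 * n / ⌊(n : ℝ) ^ σ⌋₊ * (2 + Real.log ⌊(n : ℝ) ^ σ⌋₊) +
        40 * (n : ℝ) ^ β / ⌊(n : ℝ) ^ σ⌋₊ < ((n : ℝ) + 1) ^ e₂ := by
  filter_upwards [soloT1_floor hσ0, eventually_const_mul_rpow_le_rpow he1 320,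
    eventually_const_mul_rpow_le_rpow he2 (320 / κ), eventually_const_mul_rpow_le_rpow he3 320]
    with n ⟨hn1, hK, hKle, hKge⟩ ha hb hc
  have hn0 : (0 : ℝ) < n := by linarith
  have hK0 : (0 : ℝ) < ⌊(n : ℝ) ^ σ⌋₊ := by
    exact_mod_cast (show 0 < ⌊(n : ℝ) ^ σ⌋₊ by omega)
  have hK1 : (1 : ℝ) ≤ ⌊(n : ℝ) ^ σ⌋₊ := by
    exact_mod_cast (show 1 ≤ ⌊(n : ℝ) ^ σ⌋₊ by omega)
  obtain ⟨hA, hB⟩ := soloT1_over_K (β := β) hn1 hK0 hKge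
  set K : ℝ := (↑⌊(n : ℝ) ^ σ⌋₊ : ℝ) with hKdef
  have hlogK : Real.log K ≤ 2 / κ * (n : ℝ) ^ (κ / 2) := by
    have hlogn : 0 ≤ Real.log n := Real.log_nonneg hn1
    calc Real.log K ≤ Real.log ((n : ℝ) ^ σ) := Real.log_le_log hK0 hKle
      _ = σ * Real.log n := Real.log_rpow hn0 σ
      _ ≤ Real.log n := by nlinarith
      _ ≤ (n : ℝ) ^ (κ / 2) / (κ / 2) := Real.log_le_rpow_div hn0.le (by positivity)
      _ = 2 / κ * (n : ℝ) ^ (κ / 2) := by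
          field_simp
  have h2logK : 0 ≤ 2 + Real.log K := by linarith [Real.log_nonneg hK1]
  have e : (n : ℝ) ^ (1 - σ) * (n : ℝ) ^ (κ / 2) = (n : ℝ) ^ (1 - σ + κ / 2) := by
    rw [← Real.rpow_add hn0]
  have hprod : 20 * n / K * (2 + Real.log K) ≤
      80 * (n : ℝ) ^ (1 - σ) + 80 / κ * (n : ℝ) ^ (1 - σ + κ / 2) := by
    calc 20 * n / K * (2 + Real.log K)
        ≤ 40 * (n : ℝ) ^ (1 - σ) * (2 + 2 / κ * (n : ℝ) ^ (κ / 2)) :=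
          mul_le_mul hA (by linarith) h2logK (by positivity)
      _ = 80 * (n : ℝ) ^ (1 - σ) + 80 / κ * ((n : ℝ) ^ (1 - σ) * (n : ℝ) ^ (κ / 2)) := by
          ring
      _ = 80 * (n : ℝ) ^ (1 - σ) + 80 / κ * (n : ℝ) ^ (1 - σ + κ / 2) := by rw [e]
  have hpos : 0 < (n : ℝ) ^ e₂ := by positivity
  have hmono : (n : ℝ) ^ e₂ ≤ ((n : ℝ) + 1) ^ e₂ :=
    Real.rpow_le_rpow hn0.le (by linarith) (by linarith)
  have hb' : 80 / κ * (n : ℝ) ^ (1 - σ + κ / 2) ≤ (n : ℝ) ^ e₂ / 4 := by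
    have hκ4 : 80 / κ * (n : ℝ) ^ (1 - σ + κ / 2) = (320 / κ * (n : ℝ) ^ (1 - σ + κ / 2)) / 4 := by
      ring
    rw [hκ4]
    linarith
  linarith

/-- (H) eventually `40 a (n+1)^{e₁} (n+1)^{e₂} < W / 2` (`e₁ + e₂ < ν + σ − 1`). -/
theorem soloT1_condH {σ ν e₁ e₂ : ℝ} (hσ0 : 0 < σ) (he₁ : 0 ≤ e₁) (he₂ : 0 ≤ e₂)
    (hE : e₁ + e₂ < ν + σ - 1) {a : ℝ} (ha : 0 < a) :
    ∀ᶠ n : ℕ in atTop, 40 * a * ((n : ℝ) + 1) ^ e₁ * ((n : ℝ) + 1) ^ e₂ <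
      (n : ℝ) ^ ν * ⌊(n : ℝ) ^ σ⌋₊ / (400 * n) := by
  filter_upwards [soloT1_floor hσ0,
    eventually_const_mul_rpow_le_rpow hE (800 * (40 * a * (2 : ℝ) ^ e₁ * (2 : ℝ) ^ e₂) + 1)]
    with n ⟨hn1, hK, hKle, hKge⟩ h
  have hn0 : (0 : ℝ) < n := by linarith
  have t3 := soloT1_W_lower (ν := ν) hn1 hKge
  have h1 : ((n : ℝ) + 1) ^ e₁ ≤ (2 : ℝ) ^ e₁ * (n : ℝ) ^ e₁ := by
    rw [← Real.mul_rpow (by norm_num) hn0.le]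
    exact Real.rpow_le_rpow (by positivity) (by linarith) he₁
  have h2 : ((n : ℝ) + 1) ^ e₂ ≤ (2 : ℝ) ^ e₂ * (n : ℝ) ^ e₂ := by
    rw [← Real.mul_rpow (by norm_num) hn0.le]
    exact Real.rpow_le_rpow (by positivity) (by linarith) he₂
  have hprod : 40 * a * ((n : ℝ) + 1) ^ e₁ * ((n : ℝ) + 1) ^ e₂ ≤
      40 * a * (2 : ℝ) ^ e₁ * (2 : ℝ) ^ e₂ * (n : ℝ) ^ (e₁ + e₂) := by
    rw [Real.rpow_add hn0]
    calc 40 * a * ((n : ℝ) + 1) ^ e₁ * ((n : ℝ) + 1) ^ e₂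
        = 40 * a * (((n : ℝ) + 1) ^ e₁ * ((n : ℝ) + 1) ^ e₂) := by ring
      _ ≤ 40 * a * (((2 : ℝ) ^ e₁ * (n : ℝ) ^ e₁) * ((2 : ℝ) ^ e₂ * (n : ℝ) ^ e₂)) :=
          mul_le_mul_of_nonneg_left (mul_le_mul h1 h2 (by positivity) (by positivity))
            (by positivity)
      _ = 40 * a * (2 : ℝ) ^ e₁ * (2 : ℝ) ^ e₂ * ((n : ℝ) ^ e₁ * (n : ℝ) ^ e₂) := by ring
  have hpos : 0 < (n : ℝ) ^ (e₁ + e₂) := by positivity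
  have hC : 0 ≤ 40 * a * (2 : ℝ) ^ e₁ * (2 : ℝ) ^ e₂ := by positivity
  nlinarith

/-! ## Theorem AE-1 -/

/-- **THEOREM AE-1 (kernel form).**  For `ξ` transcendental, `β > 1`, `0 < σ < 1` and any
`τ`: every `ν > 4 + β − 4σ` is an exponent of Roy's additive small value estimate at the
points `iξ`, i.e. `Set.Ioi (4 + β - 4σ) ⊆ royAdditiveSVEExponents ξ β σ τ`. -/
theorem soloT1_Ioi_subset_royAdditiveSVEExponents {ξ : ℂ} (hξ : Transcendental ℚ ξ)
    {β σ : ℝ} (τ : ℝ) (hβ : 1 < β) (hσ0 : 0 < σ) (hσ1 : σ < 1) :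
    Set.Ioi (4 + β - 4 * σ) ⊆ royAdditiveSVEExponents ξ β σ τ := by
  intro ν hν
  rw [Set.mem_Ioi] at hν
  by_contra hcon
  have hev : ∀ᶠ n : ℕ in atTop, (RoyAdditiveSmall ξ β σ τ ν n).Nonempty :=
    (Filter.not_frequently.mp hcon).mono fun n hn => not_not.mp hn
  have hξ0 : ξ ≠ 0 := by
    intro h
    apply hξ
    rw [h]
    exact isAlgebraic_zero
  have hξpos : 0 < ‖ξ‖ := norm_pos_iff.mpr hξ0
  -- the constant `c₁` of the served-set lemma
  set c₁ : ℝ := max 0 (Real.log (2 / ‖ξ‖)) with hc₁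
  have hc : Real.exp (-c₁) ≤ min 1 (‖ξ‖ / 2) := by
    refine le_min ?_ ?_
    · rw [Real.exp_le_one_iff]
      linarith [le_max_left 0 (Real.log (2 / ‖ξ‖))]
    · have h2 : 0 < 2 / ‖ξ‖ := by positivity
      calc Real.exp (-c₁) ≤ Real.exp (-Real.log (2 / ‖ξ‖)) :=
            Real.exp_le_exp.mpr (by linarith [le_max_right 0 (Real.log (2 / ‖ξ‖))])
        _ = ‖ξ‖ / 2 := by rw [Real.exp_neg, Real.exp_log h2, inv_div]
  -- exponents of the comparison sequences
  set κ : ℝ := (1 - σ) / 2 with hκ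
  have hκ0 : 0 < κ := by rw [hκ]; linarith
  set e₁ : ℝ := 1 - σ + κ with he₁
  set e₂ : ℝ := β - σ + κ with he₂
  have he₁0 : 0 < e₁ := by rw [he₁]; linarith
  have he₂0 : 0 < e₂ := by rw [he₂]; linarith
  have he12 : e₁ ≤ e₂ := by rw [he₁, he₂]; linarith
  have hE : e₁ + e₂ < ν + σ - 1 := by rw [he₁, he₂, hκ]; linarith
  set a : ℝ := (2 : ℝ) ^ e₂ + 1 with ha_def
  have h2e₂ : 0 < (2 : ℝ) ^ e₂ := by positivity
  have ha1 : 1 < a := by linarith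
  have ha0 : 0 < a := by linarith
  have h2e₁ : (2 : ℝ) ^ e₁ ≤ (2 : ℝ) ^ e₂ :=
    Real.rpow_le_rpow_of_exponent_le (by norm_num) he12
  -- all eventual conditions at once
  have hν1 : 1 < ν := by linarith
  have hall := hev.and ((eventually_ge_atTop 1).and ((soloT1_floor hσ0).and
    ((soloT1_condA hν1 c₁).and ((soloT1_condB hξ0 hσ0 (ν := ν) (by linarith)).and
    ((soloT1_condC ξ hσ0 hν1).and ((soloT1_condD hσ0 hν).and
    ((soloT1_condE ξ hσ0 (β := β) (ν := ν) (by linarith) (by linarith)).and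
    ((soloT1_condF hσ0 hσ1 (e₁ := e₁) (by rw [he₁]; linarith)).and
    ((soloT1_condG (β := β) hσ0 hσ1 hκ0 (e₂ := e₂) (by rw [he₂]; linarith)
      (by rw [he₂]; linarith) (by rw [he₂]; linarith)).and
    (soloT1_condH (ν := ν) hσ0 he₁0.le he₂0.le hE ha0))))))))))
  obtain ⟨N₀, hN₀⟩ := Filter.eventually_atTop.mp hall
  -- the Gel'fond inputs `Q n`, `n ≥ N₀` (junk `1` below `N₀`)
  have hex : ∀ n : ℕ, ∃ Q : ℤ[X], N₀ ≤ n →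
      Q ≠ 0 ∧ (Q.natDegree : ℝ) ≤ 20 * n / ⌊(n : ℝ) ^ σ⌋₊ ∧
        Q.gelfondType ≤ 20 * n / ⌊(n : ℝ) ^ σ⌋₊ * (2 + Real.log ⌊(n : ℝ) ^ σ⌋₊) +
          40 * (n : ℝ) ^ β / ⌊(n : ℝ) ^ σ⌋₊ ∧
        ‖aeval ξ Q‖ ≤ Real.exp (-((n : ℝ) ^ ν * ⌊(n : ℝ) ^ σ⌋₊ / (400 * n))) := by
    intro n
    by_cases h : N₀ ≤ n
    · obtain ⟨hne, hn1, ⟨-, hK, hKle, -⟩, h₁, ⟨h₂, h₃⟩, h₄, h₅, h₆, -⟩ := hN₀ n h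
      obtain ⟨Q, hQ⟩ := soloGI_gelfond_input hξ hβ.le hn1 hK hKle hc h₁ h₂ h₃ h₄ h₅ h₆
        hne.some_mem
      exact ⟨Q, fun _ => hQ⟩
    · exact ⟨1, fun h' => absurd h' h⟩
  choose Q hQ using hex
  -- Gel'fond's criterion with `δ_N = (N+1)^{e₁}`, `σ_N = (N+1)^{e₂}`
  obtain ⟨hδm, hδ0, -, hδr⟩ := soloT1_seq he₁0
  obtain ⟨hσm, hσ0', hσt, hσr⟩ := soloT1_seq he₂0
  have hδa : ∀ N : ℕ, (((N + 1 : ℕ) : ℝ) + 1) ^ e₁ ≤ a * (((N : ℝ) + 1) ^ e₁) := fun N => by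
    have hp : 0 < ((N : ℝ) + 1) ^ e₁ := hδ0 N
    calc (((N + 1 : ℕ) : ℝ) + 1) ^ e₁ ≤ (2 : ℝ) ^ e₁ * ((N : ℝ) + 1) ^ e₁ := hδr N
      _ ≤ a * ((N : ℝ) + 1) ^ e₁ := by
          apply mul_le_mul_of_nonneg_right _ hp.le
          linarith
  have hσa : ∀ N : ℕ, (((N + 1 : ℕ) : ℝ) + 1) ^ e₂ < a * (((N : ℝ) + 1) ^ e₂) := fun N => by
    have hp : 0 < ((N : ℝ) + 1) ^ e₂ := hσ0' N
    calc (((N + 1 : ℕ) : ℝ) + 1) ^ e₂ ≤ (2 : ℝ) ^ e₂ * ((N : ℝ) + 1) ^ e₂ := hσr N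
      _ < a * ((N : ℝ) + 1) ^ e₂ := by
          apply mul_lt_mul_of_pos_right _ hp
          linarith
  have hQcrit : ∀ N, N₀ ≤ N → Q N ≠ 0 ∧ ((Q N).natDegree : ℝ) < ((N : ℝ) + 1) ^ e₁ ∧
      (Q N).gelfondType < ((N : ℝ) + 1) ^ e₂ := fun N hN => by
    obtain ⟨hQ0, hQd, hQt, -⟩ := hQ N hN
    obtain ⟨-, -, -, -, -, -, -, -, hF, hG, -⟩ := hN₀ N hN
    exact ⟨hQ0, hQd.trans_lt hF, hQt.trans_lt hG⟩
  obtain ⟨N, hNN₀, hlow⟩ :=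
    Literature.NumberTheory.Transcendental.gelfond_criterion_not_small_values hξ a ha1
      (fun N : ℕ => ((N : ℝ) + 1) ^ e₁) (fun N : ℕ => ((N : ℝ) + 1) ^ e₂) hδm hσm hδ0 hσ0'
      hσt hδa hσa Q N₀ hQcrit
  -- compare the two bounds at this `N`
  obtain ⟨-, -, -, hup⟩ := hQ N hNN₀
  obtain ⟨-, -, -, -, -, -, -, -, -, -, hH⟩ := hN₀ N hNN₀
  have hcmp := Real.exp_le_exp.mp (hlow.trans hup)
  linarith

end Summit.Schanuel.Schanuel.Theorems
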